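import Summits.Ventures.HodgeRepro2.T5HyperbolicCharacters

/-!
# The Siegel Levi of `U(ℍ)`: the diagonal torus, `M_Y ≅ Eˣ`, and the forcing of the character

Kernel support (seat p3, cell pub-hodge-repro2) behind one sentence of §F.1 of
`route/T5-route-3.md` (the normalisation of `c_v(χ_v)`): «On the Siegel Levi `m(a) ∈ M_Y ≅ GL(Y)`
of a SPLIT `W` one has `x(m(a)) = det a ∈ E^×` and `det m(a) = det a / \overline{det a}`; … a
character of `U(W)` … is `ν′∘det` for a character `ν′` of `E¹`, and `det(M_Y) = E¹` (Hilbert 90)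
forces `ν′ = ν_χ`».

In the hyperbolic-plane model `U(ℍ) = hypUnitary E` (files 23 / 25 / 74 / 75 of this seat), with
`Y = E·e₀` the first isotropic line and `Y′ = E·e₁` the second:

* the Siegel Levi `M_Y` is the diagonal subgroup `{diag(t, t̄⁻¹)}`, the range of `diagHom`
  (`levi`); it is exactly the set of elements with both off-diagonal entries zero
  (`mem_levi_iff`), i.e. the intersection of the Borel `B = Stab(Y)` of file 25 with the
  opposite Borel `Stab(Y′)` (`mem_levi_iff_mem_borel`, `mem_levi_iff_stabilizes`);
* `m : Eˣ → M_Y`, `t ↦ diag(t, t̄⁻¹)` is injective, so `M_Y ≅ GL(Y) = Eˣ` (`leviEquiv`);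
  «`x(m(a)) = a`» is the `(0,0)`-entry (`entry_diagHom_zero_zero`) and
  «`det m(a) = a/ā`» is file 74's `detNormOne_diagHom`;
* THE FORCING: two characters of `U(ℍ)` that agree on the Levi agree everywhere
  (`eq_of_forall_diagHom_eq`), and a character whose restriction to the Levi is
  `ν ∘ (t ↦ t/t̄)` is `ν ∘ det` (`eq_comp_detNormOne_of_diagHom`) — this is the step
  «`det(M_Y) = E¹` forces `ν′ = ν_χ`» of §F.1, with `ν′` supplied by file 75's
  `exists_factor_det`.

Everything is stated for a field `E` with a ring involution (`StarRing E`); the two standing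
hypotheses of files 74 / 75 (`∃ a, star a ≠ a`: the involution is non-trivial; `∃ t ≠ 0, t·t̄ ≠ 1`:
a non-norm-one element exists) are carried as explicit hypotheses where the factorisation
theorem is used. Header declaration (README §8(d)): uses an L-value-free non-vanishing
device: no.
-/

namespace Summit.Ventures.HodgeRepro2.T5SiegelLevi

open T5UnipotentCommutator T5BorelHyperbolic T5HyperbolicDet T5HyperbolicCharacters
  T5NormOneCharacters ShimuraData.B3Characters

variable {E : Type*} [Field E] [StarRing E]

/-- The Siegel Levi `M_Y` of `U(ℍ)`: the image of the diagonal torus `t ↦ diag(t, t̄⁻¹)`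
(file 74's `diagHom`). -/
def levi : Subgroup (hypUnitary E) := (diagHom (E := E)).range

/-- Membership in the Levi, by definition: `g = diag(t, t̄⁻¹)` for some `t ∈ Eˣ`. -/
theorem mem_levi_iff_exists (g : hypUnitary E) : g ∈ levi ↔ ∃ t : Eˣ, diagHom t = g :=
  Iff.rfl

/-- The underlying matrix of `diag(t, t̄⁻¹)`. -/
theorem mat_diagHom (t : Eˣ) : mat ((diagHom t : hypUnitary E) : GL (Fin 2) E) =
    !![(t : E), 0; 0, (star (t : E))⁻¹] := by
  rw [diagHom_apply]
  rfl

/-- The four entries of `diag(t, t̄⁻¹)`. -/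
theorem entry_diagHom (t : Eˣ) :
    entry (diagHom t) 0 0 = t ∧ entry (diagHom t) 0 1 = 0 ∧ entry (diagHom t) 1 0 = 0 ∧
      entry (diagHom t) 1 1 = (star (t : E))⁻¹ := by
  refine ⟨?_, ?_, ?_, ?_⟩ <;>
  · show mat ((diagHom t : hypUnitary E) : GL (Fin 2) E) _ _ = _
    rw [mat_diagHom]
    simp

/-- «`x(m(a)) = a`»: the `(0,0)`-entry of the Levi element `m(t) = diag(t, t̄⁻¹)` is `t`. -/
theorem entry_diagHom_zero_zero (t : Eˣ) : entry (diagHom t) 0 0 = t :=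
  (entry_diagHom t).1

/-- The parametrisation `t ↦ diag(t, t̄⁻¹)` of the Levi is injective. -/
theorem diagHom_injective : Function.Injective (diagHom (E := E)) := by
  intro s t h
  have hs := entry_diagHom_zero_zero s
  rw [h, entry_diagHom_zero_zero] at hs
  exact Units.ext hs.symm

/-- `M_Y ≅ GL(Y) = Eˣ`: the Levi is isomorphic to the multiplicative group of `E`. -/
noncomputable def leviEquiv : Eˣ ≃* levi (E := E) :=
  MonoidHom.ofInjective diagHom_injective

/-- The isomorphism `leviEquiv` is the diagonal parametrisation. -/
theorem coe_leviEquiv (t : Eˣ) : ((leviEquiv t : levi (E := E)) : hypUnitary E) = diagHom t :=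
  rfl

/-- The Levi consists exactly of the elements of `U(ℍ)` with both off-diagonal entries zero:
a diagonal element `diag(a, d)` of `U(ℍ)` has `ā·d = 1`, so `d = ā⁻¹` and `g = m(a)`. -/
theorem mem_levi_iff (g : hypUnitary E) : g ∈ levi ↔ entry g 0 1 = 0 ∧ entry g 1 0 = 0 := by
  constructor
  · rintro ⟨t, rfl⟩
    exact ⟨(entry_diagHom t).2.1, (entry_diagHom t).2.2.1⟩
  · rintro ⟨h01, h10⟩
    have ha : entry g 0 0 ≠ 0 := entry_00_ne_zero g h10
    obtain ⟨h1, _⟩ := upper_relations g h10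
    have hd : entry g 1 1 = (star (entry g 0 0))⁻¹ := eq_inv_of_mul_eq_one_right h1
    refine ⟨Units.mk0 (entry g 0 0) ha, ?_⟩
    apply Subtype.ext
    apply Units.ext
    show mat ((diagHom (Units.mk0 (entry g 0 0) ha) : hypUnitary E) : GL (Fin 2) E) = mat (g : GL (Fin 2) E)
    rw [mat_diagHom, mat_eq_upper g h10, h01, hd]
    rfl

/-- The Levi is contained in the Borel `B = Stab(Y)` of file 25. -/
theorem levi_le_borel : levi (E := E) ≤ borel E := by
  intro g hg
  rw [mem_borel_iff]
  exact ((mem_levi_iff g).1 hg).2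

/-- «`M_Y = B ∩ B⁻`»: the Levi is the part of the Borel `B = Stab(Y)` that also has
vanishing `(0,1)`-entry, i.e. lies in the opposite Borel `Stab(Y′)`. -/
theorem mem_levi_iff_mem_borel (g : hypUnitary E) :
    g ∈ levi ↔ g ∈ borel E ∧ entry g 0 1 = 0 := by
  rw [mem_levi_iff, mem_borel_iff, and_comm]

/-- An element of `U(ℍ)` stabilises the second coordinate line `Y′ = E·e₁` iff its
`(0,1)`-entry vanishes. -/
theorem stabilizes_second_iff (g : hypUnitary E) :
    (∃ c : E, (mat (g : GL (Fin 2) E)).mulVec ![0, 1] = c • ![0, 1]) ↔ entry g 0 1 = 0 := by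
  constructor
  · rintro ⟨c, hc⟩
    have := congrFun hc 0
    simpa [Matrix.mulVec, dotProduct, entry] using this
  · intro h
    refine ⟨entry g 1 1, ?_⟩
    ext i
    fin_cases i <;> simp [Matrix.mulVec, dotProduct, entry] at h ⊢
    exact h

/-- «The Levi is the stabiliser of BOTH isotropic lines `Y = E·e₀` and `Y′ = E·e₁`»
(the first half is file 25's `mem_borel_iff_stabilizes`). -/
theorem mem_levi_iff_stabilizes (g : hypUnitary E) :
    g ∈ levi ↔ (∃ c : E, (mat (g : GL (Fin 2) E)).mulVec ![1, 0] = c • ![1, 0]) ∧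
      (∃ c : E, (mat (g : GL (Fin 2) E)).mulVec ![0, 1] = c • ![0, 1]) := by
  rw [mem_levi_iff_mem_borel, mem_borel_iff_stabilizes, stabilizes_second_iff]

section Forcing

variable {M : Type*} [CommGroup M]

/-- The hypothesis `∃ a, star a ≠ a` of files 74 / 75 read through `starRingAut`. -/
theorem exists_starRingAut_ne_of_star (ha : ∃ a : E, star a ≠ a) :
    ∃ a : E, starRingAut a ≠ a :=
  ha

/-- THE FORCING, first form: two characters of `U(ℍ)` (into any commutative group) that agree
on the Siegel Levi agree everywhere — because each is `ν∘det` (file 75) and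
`det(M_Y) = E¹` (file 74, Hilbert 90). -/
theorem eq_of_forall_diagHom_eq (ha : ∃ a : E, star a ≠ a) (ht : ∃ t : E, t ≠ 0 ∧ t * star t ≠ 1)
    (φ ψ : hypUnitary E →* M) (h : ∀ t : Eˣ, φ (diagHom t) = ψ (diagHom t)) : φ = ψ := by
  obtain ⟨ν, hν⟩ := exists_factor_det ha ht φ
  obtain ⟨ν', hν'⟩ := exists_factor_det ha ht ψ
  have hsurj := jHomNormOne_surjective starRingAut starRingAut_involutive
    (exists_starRingAut_ne_of_star ha)
  have hνν' : ν = ν' := by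
    apply MonoidHom.ext
    intro y
    obtain ⟨t, rfl⟩ := hsurj y
    have := h t
    rwa [hν, hν', detNormOne_diagHom] at this
  apply MonoidHom.ext
  intro g
  rw [hν, hν', hνν']

/-- THE FORCING, second form («`det(M_Y) = E¹` forces `ν′ = ν_χ`»): a character `φ` of `U(ℍ)`
whose restriction to the Levi is `ν ∘ (t ↦ t/t̄)` for a character `ν` of `E¹` equals `ν ∘ det`. -/
theorem eq_comp_detNormOne_of_diagHom (ha : ∃ a : E, star a ≠ a)
    (ht : ∃ t : E, t ≠ 0 ∧ t * star t ≠ 1) (φ : hypUnitary E →* M)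
    (ν : normOne (unitsConj (starRingAut (R := E))) →* M)
    (h : ∀ t : Eˣ, φ (diagHom t) = ν (jHomNormOne starRingAut starRingAut_involutive t)) :
    φ = ν.comp detNormOne := by
  apply eq_of_forall_diagHom_eq ha ht
  intro t
  rw [h t, MonoidHom.comp_apply, detNormOne_diagHom]

/-- The same, pointwise: `φ g = ν (det g)` for every `g ∈ U(ℍ)`. -/
theorem apply_eq_of_diagHom (ha : ∃ a : E, star a ≠ a)
    (ht : ∃ t : E, t ≠ 0 ∧ t * star t ≠ 1) (φ : hypUnitary E →* M)
    (ν : normOne (unitsConj (starRingAut (R := E))) →* M)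
    (h : ∀ t : Eˣ, φ (diagHom t) = ν (jHomNormOne starRingAut starRingAut_involutive t))
    (g : hypUnitary E) : φ g = ν (detNormOne g) := by
  rw [eq_comp_detNormOne_of_diagHom ha ht φ ν h]
  rfl

/-- The restriction of a character of `U(ℍ)` to the Levi, read on `Eˣ`, is trivial on the
`star`-fixed units (the «`χ|_{F^×} = 1`» of §F.1), so it is of the form `ν ∘ (t ↦ t/t̄)` by
file 31's Hilbert-90 factorisation: every character of `U(ℍ)` is `ν ∘ det` for the `ν` obtained
from its Levi restriction. -/
theorem exists_factor_levi (ha : ∃ a : E, star a ≠ a) (ht : ∃ t : E, t ≠ 0 ∧ t * star t ≠ 1)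
    (φ : hypUnitary E →* M) :
    ∃ ν : normOne (unitsConj (starRingAut (R := E))) →* M,
      (∀ t : Eˣ, φ (diagHom t) = ν (jHomNormOne starRingAut starRingAut_involutive t)) ∧
        φ = ν.comp detNormOne := by
  have hfix : ∀ t : Eˣ, starRingAut (t : E) = t → (φ.comp diagHom) t = 1 := by
    intro t hts
    rw [MonoidHom.comp_apply, diagHom_apply]
    exact map_diagU_of_star_eq φ ha ht (t : E) t.ne_zero hts
  obtain ⟨ν, hν⟩ := exists_factor_normOne starRingAut starRingAut_involutive
    (exists_starRingAut_ne_of_star ha) (φ.comp diagHom) hfix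
  refine ⟨ν, fun t => hν t, ?_⟩
  exact eq_comp_detNormOne_of_diagHom ha ht φ ν (fun t => hν t)

end Forcing

end Summit.Ventures.HodgeRepro2.T5SiegelLevi
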